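import Mathlib.Algebra.BigOperators.Ring.Finset
import Mathlib.Algebra.BigOperators.Fin
import Mathlib.Data.Real.Basic
import Mathlib.Data.Fintype.Prod
import Mathlib.Tactic
import HarnessLib

/-!
# Density–density lattice Hamiltonians: the electron ↔ hole PICTURE MAP, Hartree-dressed levels,
# and the double-counting bookkeeping of downfolded (cRPA / cGW-SIC) one-body levels

The interacting part of every downfolded lattice Hamiltonian of record in the cell `pub/hubbard-downfold`
(one-band `U`–`V`, three-band `d`–`p` "Emery", multi-orbital `U, U′`) is DENSITY–DENSITY. On commuting
occupation variables `n : α → ℝ` over a finite index type `α` of SPIN-ORBITALS (site × orbital × spin), with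
one-body levels `ε : α → ℝ` and pair couplings `U : α → α → ℝ` (a spin-orbital never couples to itself:
every pair sum runs over `b ≠ a`), the energy form is
`E(ε, U; n) = Σ_a ε_a n_a + ½ Σ_a Σ_{b ≠ a} U_ab n_a n_b` (`ddEnergy`). This file PROVES the elementary,
exact identities that the cell's three-band → one-band bookkeeping (INFLATION-RULES §3to1-A A.14: «which
hole-picture bare Δ_pd does a printed electron-picture level denote») keeps re-deriving by hand:

* §1 `hartree U n a = Σ_{b≠a} U_ab n_b` (the Hartree potential felt at `a`), `dressed ε U n = ε + hartree`
  — the printed downfolded DFT/GW level IS the dressed level and the double-counting-free ("dcf") level fed to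
  a solver is `t − hartree` [HirayamaMiyakeImada2013, Eq. (33)]: `dcfLevel`, `dressed_dcfLevel`; linearity
  of `hartree` in the density.
* §2 THE PICTURE MAP [EsslerEtAl2005, §2.2.4 (2.58)–(2.63), the one-band Shiba/particle–hole transformation;
  here its density–density bookkeeping for arbitrary pair couplings]: with hole occupations `h = 1 − n`
  (`holeDensity`) and HOLE LEVELS `ε^h_a = −ε_a − Σ_{b≠a} U_ab` (`holeLevel`, the full-shell dressing),
  `E(ε, U; n) = [Σ_a ε_a + ½Σ_{a≠b} U_ab] + E(ε^h, U; 1 − n)` for symmetric `U` (`ddEnergy_eq_shellConst_add`):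
  same pair couplings, shifted levels, a constant.
* §3 DRESSED LEVELS FLIP SIGN EXACTLY: `dressed ε^h U (1 − n) a = − dressed ε U n a`
  (`dressed_holeLevel_holeDensity`) — a level difference that carries the FULL Hartree potential at the
  reference density changes only its sign between pictures, with no `U_d − U_p + 4V_pd`-type correction; the
  hole-picture BARE level is `ε^h_a = −dressed ε U n a − hartree U (1 − n) a` (`holeLevel_eq`), so a bare hole
  charge-transfer energy is the dressed electron one of opposite sign PLUS the holes' Hartree potential at `d`
  MINUS that at `p` (`holeCT_eq_dressed`), and equals minus the bare electron one plus the full-shell terms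
  (`holeCT_eq_bare`).
* §4 THE PARTNER-REMOVED («U-dcf») RUNG [HirayamaMiyakeImada2013, Eq. (33) with the sum restricted to the
  on-site partner]: the level from which only the on-site opposite-spin PARTNER term `U_{a,σa} n_{σa}` has been
  removed, `sicLevel = dressed − U a (σ a) * n (σ a)` (identifier kept for tree stability — see the ⚑ GLOSS
  ERRATUM below; alias `uDcfLevel`), i.e. the level to feed a solver that treats the on-site `U` explicitly while
  every other coupling stays at mean field (the cell's «bare-e (V@MF)» rung, ruling R-dx (B)); it sits between
  bare and dressed (`sicLevel_eq`) and flips between pictures up to exactly `−U a (σ a)` (`sicLevel_hole`): at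
  this rung a `d`–`p` charge-transfer energy flips sign and gains `U_d − U_p` (`sicCT_hole`). Three rungs, three
  corrections: bare (full shell), U-dcf (`U_d − U_p`), dressed (none).
* §5 THE ADDITION-ENERGY SLOPE: for symmetric `U`, raising one occupation by `t` changes `E` by exactly
  `t · dressed ε U n a` — no `t²` term, because a spin-orbital does not interact with itself
  (`ddEnergy_addAt`).
* §6 ORBITAL (spin-summed) LANGUAGE = the printed double-counting formula [MisawaNakamuraImada2011, p. 2]:
  on `ι × Bool` with spin-independent orbital couplings `Uo` and spin-balanced occupations `n_ν/2` per spin,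
  `dressed = μ_ν + U_νν n_ν/2 + Σ_{ν′≠ν} U_νν′ n_ν′` (`dressed_orbital`).
* §7 SPECIES-UNIFORM DENSITIES: if `n` is constant on the fibres of a species map `s : α → S`, the Hartree
  potential is `Σ_t ζ_a(t) ν_t` with COORDINATION-WEIGHTED couplings `ζ_a(t) = Σ_{b≠a, s b = t} U_ab`
  (`hartree_eq_sum_species`) — the form in which `U_d`, `2·z·V_pd`, … enter the charge-transfer bookkeeping.
* §8 FLUCTUATION FORM ≡ DCF LEVELS [MisawaNakamuraImada2011, p. 2; HirayamaEtAl2019, §2.1.1 «the double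
  counting of Hartree energy is subtracted when the effective Hamiltonian is solved»]: solving printed levels
  `t` with the interaction in fluctuation form `½ΣU(n − n̄)(n − n̄)` around the reference density is, up to a
  constant, solving the dcf levels `t − hartree U n̄` with the plain interaction (`fluctForm_eq_ddEnergy_dcf`);
  the PARTIAL version (only a sub-coupling `U₂`, e.g. inter-site `V`, in fluctuation form:
  `partialFluctForm_eq_ddEnergy`) is the consistent companion of a U-dcf level; feeding a U-dcf level and
  ALSO subtracting the full Hartree potential double-subtracts the partner term (`dcfLevel_sicLevel`), whereas
  subtracting only the remaining partners returns the bare level (`sicLevel_sub_remaining`).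
* §9 THE KOHN–SHAM SELF-HARTREE TERM AND THE MACE «SIC» [MoreeEtAl2022, App. A Eq. (A15); HirayamaEtAl2019,
  §2.1.1]: a Hartree potential built from the TOTAL density also carries the SAME-spin-orbital self-interaction
  `U_self a · n a` (on-site `U_ii · n_{iσ} = U_ii n_i/2` for a spin-balanced orbital), which this file's pair
  bookkeeping (`b ≠ a`) never contains: `ksHartreeLevel = dressed + selfHartree`; the MACE self-interaction
  correction removes exactly that term, so the printed cGW-SIC level is the DRESSED level
  (`ksHartreeLevel_sub_selfHartree`), in orbital language `μ_ν + U_νν n_ν/2 + Σ_{ν′≠ν} U_νν′ n_ν′` (the cell's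
  «fl@(n̄)» reading of record, INFLATION-RULES §3to1-A A.14b; `ksHartreeLevel_orbital`, `selfHartree_orbital`).

⚑ GLOSS ERRATUM (v3, same day): versions 1–2 of this docstring and of the §4/§8 docstrings glossed `sicLevel` as
«the MACE SIC'd level» and `U a (σ a) · n (σ a)` as «the printed t^{SIC}». That attribution was WRONG (cell file
`lit/REFVALS-1.md` §B17 ⚑ ERRATUM #4; pre-registration P18 failed 8 : 1 against the cell's torus test): the MACE
SIC removes the same-spin-orbital SELF-Hartree term of §9, not the opposite-spin partner term, so the printed MACE
level is `dressed`, and `sicLevel` is the U-dcf («bare-e, V at mean field») rung. No statement of v1–v2 changed;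
only glosses and citations were re-pointed, and §9 plus the alias `uDcfLevel` were added.

Everything is PROVED (finite sums, `ring`); 0 facts, no `sorry`. WHAT THIS IS NOT: no statement about any
material or any value of `Δ_pd`; not the operator-level particle–hole transformation on Fock space (the tree's
`Literature.MathematicalPhysics.QuantumChemistry.ParticleHoleConjugation` does that for the molecular
Hamiltonian) — only its exact bookkeeping on density–density energies, which is all the downfolding literature
uses; not a claim about which rung a given code prints (that is read from the source, cell file
`lit/REFVALS-1.md` §B17); hopping terms are untouched by the map up to the sign/gauge of [EsslerEtAl2005, (2.59)]
and are not modelled here.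

References: F. H. L. Essler, H. Frahm, F. Göhmann, A. Klümper, V. E. Korepin, *The One-Dimensional Hubbard
Model* (CUP 2005) §2.2.4 · M. Hirayama, T. Miyake, M. Imada, Phys. Rev. B 87, 195144 (2013) Eq. (33) ·
T. Misawa, K. Nakamura, M. Imada, J. Phys. Soc. Jpn. 80, 023704 (2011) p. 2 · J.-B. Morée, M. Hirayama,
M. T. Schmid, Y. Yamaji, M. Imada, Phys. Rev. B 106, 235150 (2022) App. A (A14)–(A15), Table IV ·
M. Hirayama, T. Misawa, T. Ohgoe, Y. Yamaji, M. Imada, Phys. Rev. B 99, 245155 (2019) §2.1.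
AI-produced formalisation (H21, cell hubbard-downfold, seat lit-1, 2026-08-27).
-/

noncomputable section

namespace Literature.MathematicalPhysics.QuantumLattice

namespace PictureMap

open Finset

variable {α : Type*} [Fintype α] [DecidableEq α]

/-! ## §1 Hartree potential, dressed and double-counting-free levels -/

/-- The Hartree potential felt at spin-orbital `a` from the density `n` through the pair couplings `U`:
`Σ_{b ≠ a} U a b · n b` (a spin-orbital does not act on itself). This is the subtracted term of the
double-counting-free one-body level `t^{dcf}_{mm}(R_i) = t_{mm}(R_i) − Σ_{jnρ} U(R_i − R_j)⟨n_{jnρ}⟩`.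
[cite: HirayamaMiyakeImada2013, Eq. (33)] -/
def hartree (U : α → α → ℝ) (n : α → ℝ) (a : α) : ℝ := ∑ b ∈ univ.erase a, U a b * n b

/-- The Hartree-DRESSED level `ε a + Σ_{b≠a} U a b · n b` — the one-body level a mean-field (LDA/GW-like)
band structure prints when the density is `n`. [cite: HirayamaMiyakeImada2013, Eq. (33)] -/
def dressed (ε : α → ℝ) (U : α → α → ℝ) (n : α → ℝ) (a : α) : ℝ := ε a + hartree U n a

/-- The double-counting-free ("dcf") level fed to a many-body solver: printed level minus the Hartree
potential of the reference density, `t a − Σ_{b≠a} U a b · n b`. [cite: HirayamaMiyakeImada2013, Eq. (33)] -/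
def dcfLevel (t : α → ℝ) (U : α → α → ℝ) (n : α → ℝ) (a : α) : ℝ := t a - hartree U n a

/-- [cite: HirayamaMiyakeImada2013, Eq. (33)] Unfolding lemma for `hartree`. -/
theorem hartree_def (U : α → α → ℝ) (n : α → ℝ) (a : α) :
    hartree U n a = ∑ b ∈ univ.erase a, U a b * n b := rfl

/-- [cite: HirayamaMiyakeImada2013, Eq. (33)] Re-dressing the dcf level at the SAME density returns the
printed level: `dressed (dcfLevel t U n) U n = t` — the printed mean-field level is the dressed one. -/
theorem dressed_dcfLevel (t : α → ℝ) (U : α → α → ℝ) (n : α → ℝ) (a : α) :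
    dressed (dcfLevel t U n) U n a = t a := by
  unfold dressed dcfLevel; ring

/-- [cite: HirayamaMiyakeImada2013, Eq. (33)] The Hartree potential is additive in the density. -/
theorem hartree_add (U : α → α → ℝ) (n m : α → ℝ) (a : α) :
    hartree U (fun b => n b + m b) a = hartree U n a + hartree U m a := by
  unfold hartree
  rw [← Finset.sum_add_distrib]
  exact Finset.sum_congr rfl fun b _ => by ring

/-- [cite: HirayamaMiyakeImada2013, Eq. (33)] The Hartree potential is subtractive in the density. -/
theorem hartree_sub (U : α → α → ℝ) (n m : α → ℝ) (a : α) :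
    hartree U (fun b => n b - m b) a = hartree U n a - hartree U m a := by
  unfold hartree
  rw [← Finset.sum_sub_distrib]
  exact Finset.sum_congr rfl fun b _ => by ring

/-- [cite: HirayamaMiyakeImada2013, Eq. (33)] The Hartree potential is homogeneous in the density. -/
theorem hartree_smul (U : α → α → ℝ) (c : ℝ) (n : α → ℝ) (a : α) :
    hartree U (fun b => c * n b) a = c * hartree U n a := by
  unfold hartree
  rw [Finset.mul_sum]
  exact Finset.sum_congr rfl fun b _ => by ring

/-! ## §2 The picture map -/

/-- Hole occupations: `h a = 1 − n a` per spin-orbital. [cite: EsslerEtAl2005, §2.2.4 (2.60)–(2.61)] -/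
def holeDensity (n : α → ℝ) : α → ℝ := fun a => 1 - n a

/-- The full-shell density `n ≡ 1` (every spin-orbital occupied: the hole vacuum, e.g. Cu d¹⁰ O p⁶).
[cite: EsslerEtAl2005, §2.2.4 (2.60)] -/
def fullShell : α → ℝ := fun _ => 1

/-- HOLE-PICTURE LEVELS: `ε^h a = −ε a − Σ_{b≠a} U a b` — minus the electron level, dressed by the FULL shell.
[cite: EsslerEtAl2005, §2.2.4 (2.58)–(2.63)] -/
def holeLevel (ε : α → ℝ) (U : α → α → ℝ) (a : α) : ℝ := -ε a - hartree U fullShell a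

/-- The pair (interaction) energy `½ Σ_a Σ_{b≠a} U a b · n a · n b`. [cite: HirayamaMiyakeImada2013, Eq. (30)] -/
def pairEnergy (U : α → α → ℝ) (n : α → ℝ) : ℝ := (1 / 2) * ∑ a, ∑ b ∈ univ.erase a, U a b * n a * n b

/-- The density–density energy form `E(ε, U; n) = Σ_a ε a · n a + ½ Σ_a Σ_{b≠a} U a b · n a · n b`.
[cite: HirayamaMiyakeImada2013, Eq. (30)] -/
def ddEnergy (ε : α → ℝ) (U : α → α → ℝ) (n : α → ℝ) : ℝ := (∑ a, ε a * n a) + pairEnergy U n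

/-- The full-shell constant of the picture map: `Σ_a ε a + ½ Σ_{a≠b} U a b = E(ε, U; 1)`.
[cite: EsslerEtAl2005, §2.2.4 (2.61)–(2.63)] -/
def shellConst (ε : α → ℝ) (U : α → α → ℝ) : ℝ := ddEnergy ε U fullShell

/-- `U` is a symmetric pair coupling: `U a b = U b a`. [cite: HirayamaMiyakeImada2013, Eq. (30)] -/
def IsSymm (U : α → α → ℝ) : Prop := ∀ a b, U a b = U b a

omit [Fintype α] [DecidableEq α] in
/-- [cite: EsslerEtAl2005, §2.2.4] `holeDensity` unfolds pointwise. -/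
theorem holeDensity_apply (n : α → ℝ) (a : α) : holeDensity n a = 1 - n a := rfl

omit [Fintype α] [DecidableEq α] in
/-- [cite: EsslerEtAl2005, §2.2.4] Taking holes twice returns the electron density. -/
theorem holeDensity_holeDensity (n : α → ℝ) : holeDensity (holeDensity n) = n := by
  funext a; simp [holeDensity]

omit [Fintype α] [DecidableEq α] in
/-- [cite: EsslerEtAl2005, §2.2.4] The holes of the full shell are the empty lattice. -/
theorem holeDensity_fullShell : holeDensity (fullShell : α → ℝ) = fun _ => 0 := by
  funext a; simp [holeDensity, fullShell]

/-- [cite: HirayamaMiyakeImada2013, Eq. (33)] Hartree potential of the hole density = full-shell potential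
minus the electron one. -/
theorem hartree_holeDensity (U : α → α → ℝ) (n : α → ℝ) (a : α) :
    hartree U (holeDensity n) a = hartree U fullShell a - hartree U n a := by
  rw [← hartree_sub]; rfl

/-- The bilinear pair sum `Σ_a Σ_{b≠a} U a b · f a · g b` behind `pairEnergy` and `hartree`.
[cite: HirayamaMiyakeImada2013, Eq. (30)] -/
def pairSum (U : α → α → ℝ) (f g : α → ℝ) : ℝ := ∑ a, ∑ b ∈ univ.erase a, U a b * f a * g b

/-- [cite: HirayamaMiyakeImada2013, Eq. (30)] `pairEnergy = ½ · pairSum n n`. -/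
theorem pairEnergy_eq_pairSum (U : α → α → ℝ) (n : α → ℝ) :
    pairEnergy U n = (1 / 2) * pairSum U n n := rfl

/-- [cite: HirayamaMiyakeImada2013, Eq. (33)] `Σ_a f a · hartree U g a = pairSum U f g`. -/
theorem sum_mul_hartree (U : α → α → ℝ) (f g : α → ℝ) :
    ∑ a, f a * hartree U g a = pairSum U f g := by
  unfold pairSum hartree
  refine Finset.sum_congr rfl fun a _ => ?_
  rw [Finset.mul_sum]
  exact Finset.sum_congr rfl fun b _ => by ring

/-- [cite: HirayamaMiyakeImada2013, Eq. (30)] An erased pair sum is the full double sum minus its diagonal. -/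
theorem pairSum_eq_sub_diag (U : α → α → ℝ) (f g : α → ℝ) :
    pairSum U f g = (∑ a, ∑ b, U a b * f a * g b) - ∑ a, U a a * f a * g a := by
  unfold pairSum
  rw [← Finset.sum_sub_distrib]
  exact Finset.sum_congr rfl fun a _ => Finset.sum_erase_eq_sub (Finset.mem_univ a)

/-- [cite: HirayamaMiyakeImada2013, Eq. (30)] For a SYMMETRIC coupling the pair sum is symmetric in its
two density arguments. -/
theorem pairSum_comm {U : α → α → ℝ} (hU : IsSymm U) (f g : α → ℝ) :
    pairSum U f g = pairSum U g f := by
  rw [pairSum_eq_sub_diag, pairSum_eq_sub_diag, Finset.sum_comm]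
  congr 1
  · exact Finset.sum_congr rfl fun b _ => Finset.sum_congr rfl fun a _ => by rw [hU a b]; ring
  · exact Finset.sum_congr rfl fun a _ => by ring

/-- [cite: HirayamaMiyakeImada2013, Eq. (30)] `pairSum` is subtractive in the first slot. -/
theorem pairSum_sub_left (U : α → α → ℝ) (f₁ f₂ g : α → ℝ) :
    pairSum U (fun a => f₁ a - f₂ a) g = pairSum U f₁ g - pairSum U f₂ g := by
  unfold pairSum
  rw [← Finset.sum_sub_distrib]
  refine Finset.sum_congr rfl fun a _ => ?_
  rw [← Finset.sum_sub_distrib]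
  exact Finset.sum_congr rfl fun b _ => by ring

/-- [cite: HirayamaMiyakeImada2013, Eq. (30)] `pairSum` is subtractive in the second slot. -/
theorem pairSum_sub_right (U : α → α → ℝ) (f g₁ g₂ : α → ℝ) :
    pairSum U f (fun a => g₁ a - g₂ a) = pairSum U f g₁ - pairSum U f g₂ := by
  unfold pairSum
  rw [← Finset.sum_sub_distrib]
  refine Finset.sum_congr rfl fun a _ => ?_
  rw [← Finset.sum_sub_distrib]
  exact Finset.sum_congr rfl fun b _ => by ring

/-- **THE PICTURE MAP.** For a symmetric density–density coupling, the electron-picture energy at density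
`n` equals the full-shell constant plus the HOLE-picture energy — same pair couplings, hole levels
`ε^h = −ε − Σ_{b≠a} U`, hole density `1 − n`:
`E(ε, U; n) = [Σ ε + ½ Σ_{a≠b} U] + E(ε^h, U; 1 − n)`.
[cite: EsslerEtAl2005, §2.2.4 (2.58)–(2.63)] (the one-band case is printed there as the double Shiba
transformation `N ↦ 2L − N`, `H(u) ↦ H(u)` in the symmetric form (2.31); this is its bookkeeping for
arbitrary pair couplings). -/
theorem ddEnergy_eq_shellConst_add {U : α → α → ℝ} (hU : IsSymm U) (ε : α → ℝ) (n : α → ℝ) :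
    ddEnergy ε U n = shellConst ε U + ddEnergy (holeLevel ε U) U (holeDensity n) := by
  -- express everything through `pairSum` and three scalar sums
  have h1 : ∑ a, holeLevel ε U a * holeDensity n a
      = -(∑ a, ε a) + (∑ a, ε a * n a) - pairSum U fullShell fullShell + pairSum U n fullShell := by
    have e1 : ∀ a, holeLevel ε U a * holeDensity n a
        = -(ε a) + ε a * n a - fullShell a * hartree U fullShell a + n a * hartree U fullShell a := by
      intro a; simp only [holeLevel, holeDensity, fullShell]; ring
    simp only [e1, Finset.sum_add_distrib, Finset.sum_sub_distrib, Finset.sum_neg_distrib,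
      sum_mul_hartree]
  have h2 : pairSum U (holeDensity n) (holeDensity n)
      = pairSum U fullShell fullShell - pairSum U n fullShell - pairSum U fullShell n + pairSum U n n := by
    have : holeDensity n = fun a => fullShell a - n a := by funext a; simp [holeDensity, fullShell]
    rw [this, pairSum_sub_left, pairSum_sub_right, pairSum_sub_right]; ring
  have h3 : pairSum U fullShell n = pairSum U n fullShell := pairSum_comm hU _ _
  have h4 : (∑ a, ε a * fullShell a) = ∑ a, ε a :=
    Finset.sum_congr rfl fun a _ => by simp [fullShell]
  unfold shellConst ddEnergy
  rw [pairEnergy_eq_pairSum, pairEnergy_eq_pairSum, pairEnergy_eq_pairSum, h1, h2, h3, h4]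
  ring

/-! ## §3 Dressed levels flip sign exactly; bare hole levels -/

/-- **DRESSED LEVELS FLIP SIGN EXACTLY** between pictures: dressing the hole levels by the hole density
`1 − n` gives minus the electron level dressed by `n` — no interaction correction survives at the dressed rung.
[cite: HirayamaMiyakeImada2013, Eq. (33)] (dressing); [cite: EsslerEtAl2005, §2.2.4] (map). -/
theorem dressed_holeLevel_holeDensity (ε : α → ℝ) (U : α → α → ℝ) (n : α → ℝ) (a : α) :
    dressed (holeLevel ε U) U (holeDensity n) a = -dressed ε U n a := by
  unfold dressed holeLevel
  rw [hartree_holeDensity]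
  ring

/-- The BARE hole level in terms of electron-picture data: `ε^h a = −dressed ε U n a − hartree U (1 − n) a`
(minus the dressed electron level, minus the Hartree potential OF THE HOLES). [cite: EsslerEtAl2005, §2.2.4];
[cite: HirayamaMiyakeImada2013, Eq. (33)] -/
theorem holeLevel_eq (ε : α → ℝ) (U : α → α → ℝ) (n : α → ℝ) (a : α) :
    holeLevel ε U a = -dressed ε U n a - hartree U (holeDensity n) a := by
  unfold dressed holeLevel
  rw [hartree_holeDensity]
  ring

/-- **Hole-picture BARE charge-transfer energy from DRESSED electron levels**: for two spin-orbitals `d, p`,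
`ε^h p − ε^h d = (dressed_d − dressed_p)(n) + (hartree U (1−n) d − hartree U (1−n) p)` — the dressed
electron level difference with its sign flipped, PLUS the holes' Hartree potential at `d` MINUS that at `p`.
[cite: EsslerEtAl2005, §2.2.4]; [cite: HirayamaMiyakeImada2013, Eq. (33)] -/
theorem holeCT_eq_dressed (ε : α → ℝ) (U : α → α → ℝ) (n : α → ℝ) (d p : α) :
    holeLevel ε U p - holeLevel ε U d
      = (dressed ε U n d - dressed ε U n p)
        + (hartree U (holeDensity n) d - hartree U (holeDensity n) p) := by
  rw [holeLevel_eq ε U n p, holeLevel_eq ε U n d]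
  ring

/-- **Hole-picture bare charge-transfer energy from BARE electron levels**: `ε^h p − ε^h d =
−(ε p − ε d) + (hartree U 1 d − hartree U 1 p)` — sign flip plus the FULL-SHELL Hartree difference (for a
`CuO₂` `d`–`p` pair with nearest-neighbour couplings this is the familiar `U_d − U_p + 2(z_d − z_p)V_pd`-type
term, see `hartree_eq_sum_species`). [cite: EsslerEtAl2005, §2.2.4] -/
theorem holeCT_eq_bare (ε : α → ℝ) (U : α → α → ℝ) (d p : α) :
    holeLevel ε U p - holeLevel ε U d
      = -(ε p - ε d) + (hartree U fullShell d - hartree U fullShell p) := by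
  unfold holeLevel; ring

/-- The electron-picture bare level difference recovered from a DRESSED (printed) one:
`ε p − ε d = (dressed_p − dressed_d)(n) − (hartree U n p − hartree U n d)`.
[cite: HirayamaMiyakeImada2013, Eq. (33)] -/
theorem bareCT_eq_dressed (ε : α → ℝ) (U : α → α → ℝ) (n : α → ℝ) (d p : α) :
    ε p - ε d = (dressed ε U n p - dressed ε U n d) - (hartree U n p - hartree U n d) := by
  unfold dressed; ring

/-! ## §4 The partner-removed («U-dcf») rung: only the on-site opposite-spin partner term removed -/

/-- The PARTNER-REMOVED («U-dcf») level: the dressed level with ONLY the on-site opposite-spin partner term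
`U a (σ a) · n (σ a)` removed, `σ a` being the opposite-spin partner of the same orbital (`U a (σ a) = U_ii`,
`n (σ a) = n_i/2` for a spin-balanced density) — the double-counting-free level with respect to the on-site
coupling ALONE, i.e. what a solver that treats `U` explicitly and every other coupling at mean field must be fed
(cell ruling R-dx (B): the «bare-e (V@MF)» rung). ⚑ The identifier is historical: this is NOT the MACE
self-interaction-corrected level (that one is `dressed`, §9). [cite: HirayamaMiyakeImada2013, Eq. (33)] -/
def sicLevel (ε : α → ℝ) (U : α → α → ℝ) (n : α → ℝ) (σ : α → α) (a : α) : ℝ :=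
  dressed ε U n a - U a (σ a) * n (σ a)

/-- The same object under its descriptive name: the U-dcf level (dcf with respect to the on-site partner
coupling only). [cite: HirayamaMiyakeImada2013, Eq. (33)] -/
abbrev uDcfLevel (ε : α → ℝ) (U : α → α → ℝ) (n : α → ℝ) (σ : α → α) (a : α) : ℝ := sicLevel ε U n σ a

/-- [cite: HirayamaMiyakeImada2013, Eq. (33)] `uDcfLevel = sicLevel` (definitional). -/
theorem uDcfLevel_eq_sicLevel (ε : α → ℝ) (U : α → α → ℝ) (n : α → ℝ) (σ : α → α) (a : α) :
    uDcfLevel ε U n σ a = sicLevel ε U n σ a := rfl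

/-- [cite: HirayamaMiyakeImada2013, Eq. (33)] The U-dcf level is the bare level dressed by every partner
EXCEPT the on-site opposite-spin one: `sicLevel = ε a + Σ_{b ≠ a, b ≠ σ a} U a b · n b` (for `σ a ≠ a`). -/
theorem sicLevel_eq (ε : α → ℝ) (U : α → α → ℝ) (n : α → ℝ) {σ : α → α} {a : α} (hσ : σ a ≠ a) :
    sicLevel ε U n σ a = ε a + ∑ b ∈ (univ.erase a).erase (σ a), U a b * n b := by
  unfold sicLevel dressed hartree
  rw [Finset.sum_erase_eq_sub (Finset.mem_erase.mpr ⟨hσ, Finset.mem_univ _⟩)]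
  ring

/-- [cite: HirayamaMiyakeImada2013, Eq. (33)] The three rungs: `dressed = sicLevel + partner term` and
`sicLevel = bare + (hartree − partner term)`. -/
theorem dressed_eq_sicLevel_add (ε : α → ℝ) (U : α → α → ℝ) (n : α → ℝ) (σ : α → α) (a : α) :
    dressed ε U n a = sicLevel ε U n σ a + U a (σ a) * n (σ a) := by
  unfold sicLevel; ring

/-- **The U-dcf rung flips between pictures up to exactly `−U a (σ a)`**:
`sicLevel ε^h U (1 − n) σ a = −sicLevel ε U n σ a − U a (σ a)`. [cite: HirayamaMiyakeImada2013, Eq. (33)];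
[cite: EsslerEtAl2005, §2.2.4] -/
theorem sicLevel_hole (ε : α → ℝ) (U : α → α → ℝ) (n : α → ℝ) (σ : α → α) (a : α) :
    sicLevel (holeLevel ε U) U (holeDensity n) σ a = -sicLevel ε U n σ a - U a (σ a) := by
  unfold sicLevel
  rw [dressed_holeLevel_holeDensity, holeDensity_apply]
  ring

/-- **Charge-transfer energy at the U-dcf rung**: between pictures it flips sign and gains exactly
`U d (σ d) − U p (σ p)` (= `U_d − U_p` on-site):
`sic^h_p − sic^h_d = −(sic_p − sic_d) + (U d (σ d) − U p (σ p))`. [cite: HirayamaMiyakeImada2013, Eq. (33)];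
[cite: EsslerEtAl2005, §2.2.4] -/
theorem sicCT_hole (ε : α → ℝ) (U : α → α → ℝ) (n : α → ℝ) (σ : α → α) (d p : α) :
    sicLevel (holeLevel ε U) U (holeDensity n) σ p - sicLevel (holeLevel ε U) U (holeDensity n) σ d
      = -(sicLevel ε U n σ p - sicLevel ε U n σ d) + (U d (σ d) - U p (σ p)) := by
  rw [sicLevel_hole, sicLevel_hole]; ring

/-- **Charge-transfer energy at the DRESSED rung**: a pure sign flip, no correction.
[cite: HirayamaMiyakeImada2013, Eq. (33)]; [cite: EsslerEtAl2005, §2.2.4] -/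
theorem dressedCT_hole (ε : α → ℝ) (U : α → α → ℝ) (n : α → ℝ) (d p : α) :
    dressed (holeLevel ε U) U (holeDensity n) p - dressed (holeLevel ε U) U (holeDensity n) d
      = -(dressed ε U n p - dressed ε U n d) := by
  rw [dressed_holeLevel_holeDensity, dressed_holeLevel_holeDensity]; ring

/-! ## §5 The dressed level is the exact addition-energy slope -/

/-- Raising the occupation of ONE spin-orbital `a` by `t`. [cite: HirayamaMiyakeImada2013, Eq. (30)] -/
def addAt (n : α → ℝ) (a : α) (t : ℝ) : α → ℝ := fun b => n b + if b = a then t else 0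

omit [Fintype α] in
/-- [cite: HirayamaMiyakeImada2013, Eq. (30)] `addAt` at the raised index. -/
theorem addAt_self (n : α → ℝ) (a : α) (t : ℝ) : addAt n a t a = n a + t := by simp [addAt]

omit [Fintype α] in
/-- [cite: HirayamaMiyakeImada2013, Eq. (30)] `addAt` elsewhere. -/
theorem addAt_of_ne (n : α → ℝ) {a b : α} (h : b ≠ a) (t : ℝ) : addAt n a t b = n b := by
  simp [addAt, h]

/-- [cite: HirayamaMiyakeImada2013, Eq. (33)] The Hartree potential of a single raised occupation:
at `a` itself nothing changes (no self-interaction) … -/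
theorem hartree_addAt_self (U : α → α → ℝ) (n : α → ℝ) (a : α) (t : ℝ) :
    hartree U (addAt n a t) a = hartree U n a := by
  unfold hartree
  exact Finset.sum_congr rfl fun b hb => by rw [addAt_of_ne n (Finset.ne_of_mem_erase hb)]

/-- [cite: HirayamaMiyakeImada2013, Eq. (33)] … and at `c ≠ a` it rises by `U c a · t`. -/
theorem hartree_addAt_of_ne (U : α → α → ℝ) (n : α → ℝ) {a c : α} (h : c ≠ a) (t : ℝ) :
    hartree U (addAt n a t) c = hartree U n c + U c a * t := by
  unfold hartree
  have ha : a ∈ univ.erase c := Finset.mem_erase.mpr ⟨h.symm, Finset.mem_univ a⟩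
  rw [← Finset.add_sum_erase _ _ ha, ← Finset.add_sum_erase _ _ ha, addAt_self]
  have : ∑ x ∈ (univ.erase c).erase a, U c x * addAt n a t x = ∑ x ∈ (univ.erase c).erase a, U c x * n x :=
    Finset.sum_congr rfl fun b hb => by rw [addAt_of_ne n (Finset.ne_of_mem_erase hb)]
  rw [this]; ring

/-- **THE ADDITION-ENERGY SLOPE IS THE DRESSED LEVEL, EXACTLY** (symmetric `U`): raising `n a` by `t` changes
the density–density energy by `t · dressed ε U n a`, with no `t²` term — a spin-orbital does not interact with
itself, so `E` is affine along each single coordinate. [cite: HirayamaMiyakeImada2013, Eq. (30), (33)] -/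
theorem ddEnergy_addAt {U : α → α → ℝ} (hU : IsSymm U) (ε : α → ℝ) (n : α → ℝ) (a : α) (t : ℝ) :
    ddEnergy ε U (addAt n a t) = ddEnergy ε U n + t * dressed ε U n a := by
  -- one-body part
  have h1 : ∑ b, ε b * addAt n a t b = (∑ b, ε b * n b) + t * ε a := by
    have : ∀ b, ε b * addAt n a t b = ε b * n b + if b = a then t * ε a else 0 := by
      intro b; by_cases hb : b = a
      · subst hb; simp [addAt_self]; ring
      · simp [addAt_of_ne n hb, hb]
    simp only [this, Finset.sum_add_distrib, Finset.sum_ite_eq', Finset.mem_univ, if_true]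
  -- pair part via `pairSum`: Σ_c (addAt c) · hartree(addAt) c
  have h2 : pairSum U (addAt n a t) (addAt n a t) = pairSum U n n + 2 * t * hartree U n a := by
    rw [← sum_mul_hartree, ← sum_mul_hartree]
    have ha : a ∈ (univ : Finset α) := Finset.mem_univ a
    rw [← Finset.add_sum_erase _ _ ha, ← Finset.add_sum_erase _ _ ha, addAt_self, hartree_addAt_self]
    have : ∑ c ∈ univ.erase a, addAt n a t c * hartree U (addAt n a t) c
        = (∑ c ∈ univ.erase a, n c * hartree U n c) + t * ∑ c ∈ univ.erase a, U a c * n c := by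
      rw [Finset.mul_sum, ← Finset.sum_add_distrib]
      refine Finset.sum_congr rfl fun c hc => ?_
      have hca : c ≠ a := Finset.ne_of_mem_erase hc
      rw [addAt_of_ne n hca, hartree_addAt_of_ne U n hca, hU c a]; ring
    rw [this, ← hartree_def]; ring
  unfold ddEnergy dressed
  rw [pairEnergy_eq_pairSum, pairEnergy_eq_pairSum, h1, h2]
  ring

/-! ## §6 Orbital (spin-summed) language: the printed double-counting formula -/

section Orbital

variable {ι : Type*} [Fintype ι] [DecidableEq ι]

/-- Spin-independent orbital couplings lifted to spin-orbitals `ι × Bool`: the coupling of `(ν, s)` with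
`(ν′, s′)` is `Uo ν ν′` (intra-orbital opposite-spin `= U_νν`, inter-orbital any spins `= U_νν′`; the
same-spin same-orbital entry is never summed). [cite: MisawaNakamuraImada2011, p. 2] -/
def spinOrbU (Uo : ι → ι → ℝ) : ι × Bool → ι × Bool → ℝ := fun x y => Uo x.1 y.1

/-- Spin-balanced spin-orbital density from orbital occupations `no ν ∈ [0, 2]`: `n (ν, s) = no ν / 2`.
[cite: MisawaNakamuraImada2011, p. 2] -/
def halfFill (no : ι → ℝ) : ι × Bool → ℝ := fun x => no x.1 / 2

/-- **The printed multi-band double-counting formula** [cite: MisawaNakamuraImada2011, p. 2]: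
«`μ̃_ν = μ_ν + Σ_{ν′} U_νν′ n_ν′ + U_νν n_ν/2` … already included in the LDA calculations … we correct `μ_ν`
so as to satisfy `μ̃_ν = μ^LDA_ν`» — in spin-orbital language `μ̃` is `dressed`: for spin-independent
couplings and a spin-balanced density,
`dressed μ (spinOrbU Uo) (halfFill no) (ν, s) = μ (ν, s) + Uo ν ν · no ν / 2 + Σ_{ν′ ≠ ν} Uo ν ν′ · no ν′`
(the printed `Σ_{ν′}` runs over `ν′ ≠ ν`, as its separate self term shows). -/
theorem dressed_orbital (μ : ι × Bool → ℝ) (Uo : ι → ι → ℝ) (no : ι → ℝ) (ν : ι) (s : Bool) :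
    dressed μ (spinOrbU Uo) (halfFill no) (ν, s)
      = μ (ν, s) + Uo ν ν * no ν / 2 + ∑ ν' ∈ univ.erase ν, Uo ν ν' * no ν' := by
  unfold dressed hartree spinOrbU halfFill
  rw [Finset.sum_erase_eq_sub (Finset.mem_univ _), Fintype.sum_prod_type]
  simp only [Fintype.sum_bool]
  rw [Finset.sum_erase_eq_sub (Finset.mem_univ ν)]
  have : ∑ x, (Uo ν x * (no x / 2) + Uo ν x * (no x / 2)) = ∑ x, Uo ν x * no x :=
    Finset.sum_congr rfl fun x _ => by ring
  rw [this]; ring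

/-- [cite: MisawaNakamuraImada2011, p. 2] Hence the solver-ready ("dcf") orbital level is the printed one
minus `U_νν n_ν/2 + Σ_{ν′≠ν} U_νν′ n_ν′`. -/
theorem dcfLevel_orbital (t : ι × Bool → ℝ) (Uo : ι → ι → ℝ) (no : ι → ℝ) (ν : ι) (s : Bool) :
    dcfLevel t (spinOrbU Uo) (halfFill no) (ν, s)
      = t (ν, s) - (Uo ν ν * no ν / 2 + ∑ ν' ∈ univ.erase ν, Uo ν ν' * no ν') := by
  have h := dressed_orbital t Uo no ν s
  unfold dressed at h
  unfold dcfLevel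
  linarith

end Orbital

/-! ## §7 Species-uniform densities: coordination-weighted couplings -/

section Species

variable {S : Type*} [Fintype S] [DecidableEq S]

/-- The COORDINATION-WEIGHTED coupling of spin-orbital `a` to species `t`: `ζ_a(t) = Σ_{b ≠ a, s b = t} U a b`
(e.g. for a Cu-`d` spin-orbital and `t` = the O-`p` species with nearest-neighbour `V_pd` only:
`ζ = 2 · z_d · V_pd`, `z_d = 4` oxygen neighbours × 2 spins; for `t` = its own orbital: `ζ = U_d`, the one
opposite-spin partner). [cite: HirayamaMiyakeImada2013, Eq. (33)] -/
def speciesCoupling (U : α → α → ℝ) (s : α → S) (a : α) (t : S) : ℝ :=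
  ∑ b ∈ (univ.erase a).filter (fun b => s b = t), U a b

/-- **Hartree potential of a species-uniform density**: if `n b = ν (s b)` depends only on the species, then
`hartree U n a = Σ_t ζ_a(t) · ν t`. [cite: HirayamaMiyakeImada2013, Eq. (33)] -/
theorem hartree_eq_sum_species (U : α → α → ℝ) (s : α → S) (ν : S → ℝ) {n : α → ℝ}
    (hn : ∀ b, n b = ν (s b)) (a : α) :
    hartree U n a = ∑ t, speciesCoupling U s a t * ν t := by
  unfold hartree speciesCoupling
  rw [← Finset.sum_fiberwise (univ.erase a) s (fun b => U a b * n b)]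
  refine Finset.sum_congr rfl fun t _ => ?_
  rw [Finset.sum_mul]
  refine Finset.sum_congr rfl fun b hb => ?_
  rw [hn b, (Finset.mem_filter.mp hb).2]

/-- **Bare hole charge-transfer energy in coordination form**: with the full shell uniform (`ν ≡ 1`),
`ε^h p − ε^h d = −(ε p − ε d) + Σ_t (ζ_d(t) − ζ_p(t))`. [cite: EsslerEtAl2005, §2.2.4];
[cite: HirayamaMiyakeImada2013, Eq. (33)] -/
theorem holeCT_eq_bare_species (ε : α → ℝ) (U : α → α → ℝ) (s : α → S) (d p : α) :
    holeLevel ε U p - holeLevel ε U d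
      = -(ε p - ε d) + ∑ t, (speciesCoupling U s d t - speciesCoupling U s p t) := by
  rw [holeCT_eq_bare, hartree_eq_sum_species U s (fun _ => (1 : ℝ)) (n := fullShell) (fun _ => rfl) d,
    hartree_eq_sum_species U s (fun _ => (1 : ℝ)) (n := fullShell) (fun _ => rfl) p,
    ← Finset.sum_sub_distrib]
  congr 1
  exact Finset.sum_congr rfl fun t _ => by ring

/-- **Bare hole charge-transfer energy from dressed electron levels, coordination form**: with hole
occupations uniform by species, `h b = η (s b)`,
`ε^h p − ε^h d = (dressed_d − dressed_p)(n) + Σ_t (ζ_d(t) − ζ_p(t)) · η t` — few holes ⇒ small correction.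
[cite: EsslerEtAl2005, §2.2.4]; [cite: HirayamaMiyakeImada2013, Eq. (33)] -/
theorem holeCT_eq_dressed_species (ε : α → ℝ) (U : α → α → ℝ) (n : α → ℝ) (s : α → S) (η : S → ℝ)
    (hη : ∀ b, holeDensity n b = η (s b)) (d p : α) :
    holeLevel ε U p - holeLevel ε U d
      = (dressed ε U n d - dressed ε U n p)
        + ∑ t, (speciesCoupling U s d t - speciesCoupling U s p t) * η t := by
  rw [holeCT_eq_dressed ε U n, hartree_eq_sum_species U s η hη d, hartree_eq_sum_species U s η hη p,
    ← Finset.sum_sub_distrib]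
  congr 1
  exact Finset.sum_congr rfl fun t _ => by ring

end Species

end PictureMap

/-! ## §8 Fluctuation form ≡ double-counting-free levels (the «solve-time subtraction» made exact) -/

namespace PictureMap

open Finset

variable {α : Type*} [Fintype α] [DecidableEq α]

/-- [cite: HirayamaMiyakeImada2013, Eq. (33)] `hartree` is additive in the COUPLING. -/
theorem hartree_addCoupling (U₁ U₂ : α → α → ℝ) (n : α → ℝ) (a : α) :
    hartree (fun a b => U₁ a b + U₂ a b) n a = hartree U₁ n a + hartree U₂ n a := by
  unfold hartree
  rw [← Finset.sum_add_distrib]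
  exact Finset.sum_congr rfl fun b _ => by ring

/-- [cite: HirayamaMiyakeImada2013, Eq. (30)] `pairSum` is additive in the COUPLING. -/
theorem pairSum_addCoupling (U₁ U₂ : α → α → ℝ) (f g : α → ℝ) :
    pairSum (fun a b => U₁ a b + U₂ a b) f g = pairSum U₁ f g + pairSum U₂ f g := by
  unfold pairSum
  rw [← Finset.sum_add_distrib]
  refine Finset.sum_congr rfl fun a _ => ?_
  rw [← Finset.sum_add_distrib]
  exact Finset.sum_congr rfl fun b _ => by ring

/-- The FLUCTUATION-FORM pair energy around a reference density `n̄`: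
`½ Σ_a Σ_{b≠a} U a b (n a − n̄ a)(n b − n̄ b)` — the interaction «after eliminating the double counting in
the Hartree terms» at reference occupations `n̄`. [cite: MisawaNakamuraImada2011, p. 2];
[cite: HirayamaEtAl2019, §2.1.1] -/
def fluctPairEnergy (U : α → α → ℝ) (nbar n : α → ℝ) : ℝ :=
  (1 / 2) * pairSum U (fun a => n a - nbar a) (fun a => n a - nbar a)

/-- **FLUCTUATION FORM ≡ DCF LEVELS** (symmetric `U`): solving the PRINTED (dressed-at-`n̄`) levels `t` with the
interaction in fluctuation form around `n̄` is, up to the constant `pairEnergy U n̄`, the same energy function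
as solving the double-counting-free levels `t − hartree U n̄` with the PLAIN interaction:
`Σ t n + ½ΣU(n − n̄)(n − n̄) = E(dcfLevel t U n̄, U; n) + pairEnergy U n̄`.
[cite: MisawaNakamuraImada2011, p. 2]; [cite: HirayamaMiyakeImada2013, Eq. (33)] -/
theorem fluctForm_eq_ddEnergy_dcf {U : α → α → ℝ} (hU : IsSymm U) (t nbar n : α → ℝ) :
    (∑ a, t a * n a) + fluctPairEnergy U nbar n
      = ddEnergy (dcfLevel t U nbar) U n + pairEnergy U nbar := by
  unfold fluctPairEnergy ddEnergy dcfLevel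
  rw [pairEnergy_eq_pairSum, pairEnergy_eq_pairSum, pairSum_sub_left, pairSum_sub_right,
    pairSum_sub_right, pairSum_comm hU nbar n, ← sum_mul_hartree U n nbar]
  have : ∑ a, (t a - hartree U nbar a) * n a = (∑ a, t a * n a) - ∑ a, n a * hartree U nbar a := by
    rw [← Finset.sum_sub_distrib]; exact Finset.sum_congr rfl fun a _ => by ring
  rw [this]; ring

/-- **PARTIAL FLUCTUATION FORM** (symmetric `U₂`): if only the couplings `U₂` are put in fluctuation form around
`n̄` (e.g. the inter-site `V` part) while `U₁` is kept plain (e.g. the on-site `U`, treated explicitly by the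
solver), the equivalent plain-interaction model has levels
`t − hartree U₂ n̄` — dcf with respect to `U₂` ONLY — and the full coupling `U₁ + U₂`:
`Σ t n + ½ΣU₁ n n + ½ΣU₂(n − n̄)(n − n̄) = E(t − hartree U₂ n̄, U₁ + U₂; n) + pairEnergy U₂ n̄`.
[cite: MisawaNakamuraImada2011, p. 2]; [cite: HirayamaEtAl2019, §2.1.1] -/
theorem partialFluctForm_eq_ddEnergy {U₁ U₂ : α → α → ℝ} (hU₂ : IsSymm U₂) (t nbar n : α → ℝ) :
    (∑ a, t a * n a) + pairEnergy U₁ n + fluctPairEnergy U₂ nbar n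
      = ddEnergy (dcfLevel t U₂ nbar) (fun a b => U₁ a b + U₂ a b) n + pairEnergy U₂ nbar := by
  have h := fluctForm_eq_ddEnergy_dcf hU₂ t nbar n
  unfold ddEnergy at h ⊢
  rw [pairEnergy_eq_pairSum U₁, pairEnergy_eq_pairSum (fun a b => U₁ a b + U₂ a b),
    pairSum_addCoupling]
  rw [pairEnergy_eq_pairSum U₂ n] at h
  linarith

/-- **Do not subtract twice**: feeding a U-dcf level (partner term `U a (σ a) n̄ (σ a)` already removed) and
then ALSO subtracting the full Hartree potential `hartree U n̄` double-subtracts the partner term — the resulting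
level lies `U a (σ a) * n̄ (σ a)` BELOW the bare one:
`dcfLevel (sicLevel ε U n̄ σ) U n̄ a = ε a − U a (σ a) * n̄ (σ a)`. [cite: HirayamaMiyakeImada2013, Eq. (33)] -/
theorem dcfLevel_sicLevel (ε : α → ℝ) (U : α → α → ℝ) (nbar : α → ℝ) (σ : α → α) (a : α) :
    dcfLevel (sicLevel ε U nbar σ) U nbar a = ε a - U a (σ a) * nbar (σ a) := by
  unfold dcfLevel sicLevel dressed; ring

/-- … whereas subtracting from a U-dcf level only the REMAINING Hartree potential (all partners except the
on-site opposite-spin one) returns the bare level exactly (`σ a ≠ a`):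
`sicLevel ε U n̄ σ a − Σ_{b ≠ a, b ≠ σ a} U a b n̄ b = ε a`. [cite: HirayamaMiyakeImada2013, Eq. (33)];
[cite: HirayamaEtAl2019, §2.1.1] -/
theorem sicLevel_sub_remaining (ε : α → ℝ) (U : α → α → ℝ) (nbar : α → ℝ) {σ : α → α} {a : α}
    (hσ : σ a ≠ a) :
    sicLevel ε U nbar σ a - ∑ b ∈ (univ.erase a).erase (σ a), U a b * nbar b = ε a := by
  rw [sicLevel_eq ε U nbar hσ]; ring


/-! ## §9 The Kohn–Sham self-Hartree term and the MACE self-interaction correction -/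

/-- The SAME-spin-orbital SELF-Hartree term `U_self a · n a` that a Hartree potential built from the TOTAL
density carries (on-site: `U_ii · n_{iσ}`, `= U_ii n_i/2` for a spin-balanced orbital) — the term the MACE
«self-interaction correction» `t^{SIC}_i = −U_ii(0) n_i/2` removes because the intra-space exchange that would
cancel it has been excluded from the constrained self-energy. [cite: MoreeEtAl2022, App. A Eq. (A15)] -/
def selfHartree (Uself : α → ℝ) (n : α → ℝ) (a : α) : ℝ := Uself a * n a

/-- A KOHN–SHAM-LIKE (total-density Hartree) level: the physically dressed level PLUS the same-spin-orbital
self-Hartree term. [cite: MoreeEtAl2022, App. A Eq. (A14)–(A15)]; [cite: HirayamaEtAl2019, §2.1.1] -/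
def ksHartreeLevel (ε : α → ℝ) (U : α → α → ℝ) (Uself : α → ℝ) (n : α → ℝ) (a : α) : ℝ :=
  dressed ε U n a + selfHartree Uself n a

/-- **The MACE SIC'd level is the DRESSED level**: removing the self-Hartree term from a total-density Hartree
level leaves exactly `dressed ε U n a = ε a + Σ_{b≠a} U a b · n b` — the physical opposite-spin on-site term
`U_ii n_i/2` and every inter-orbital / inter-site Hartree term stay inside (the cell's «fl@(n̄)» reading of
record; «the double counting of Hartree energy is subtracted when the effective Hamiltonian is solved»).
[cite: MoreeEtAl2022, App. A Eq. (A15)]; [cite: HirayamaEtAl2019, §2.1.1] -/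
theorem ksHartreeLevel_sub_selfHartree (ε : α → ℝ) (U : α → α → ℝ) (Uself : α → ℝ) (n : α → ℝ) (a : α) :
    ksHartreeLevel ε U Uself n a - selfHartree Uself n a = dressed ε U n a := by
  unfold ksHartreeLevel; ring

/-- [cite: MoreeEtAl2022, App. A Eq. (A15)] The SIC'd level differs from the U-dcf level of §4 by exactly the
on-site partner term: `(ksHartreeLevel − selfHartree) − sicLevel = U a (σ a) · n (σ a)` — the two objects the
v1 gloss conflated are one `U_ii n_i/2` apart. -/
theorem ksHartreeLevel_sub_selfHartree_sub_sicLevel (ε : α → ℝ) (U : α → α → ℝ) (Uself : α → ℝ)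
    (n : α → ℝ) (σ : α → α) (a : α) :
    (ksHartreeLevel ε U Uself n a - selfHartree Uself n a) - sicLevel ε U n σ a = U a (σ a) * n (σ a) := by
  rw [ksHartreeLevel_sub_selfHartree, dressed_eq_sicLevel_add ε U n σ a]; ring

section OrbitalSelf

variable {ι : Type*} [Fintype ι] [DecidableEq ι]

omit [Fintype ι] [DecidableEq ι] in
/-- [cite: MoreeEtAl2022, App. A Eq. (A15)] In orbital language with spin-independent couplings and a
spin-balanced density the self-Hartree term is the printed `|t^{SIC}_i| = U_ii n_i/2`:
`selfHartree (fun x => Uo x.1 x.1) (halfFill no) (ν, s) = Uo ν ν * no ν / 2`. -/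
theorem selfHartree_orbital (Uo : ι → ι → ℝ) (no : ι → ℝ) (ν : ι) (s : Bool) :
    selfHartree (fun x : ι × Bool => Uo x.1 x.1) (halfFill no) (ν, s) = Uo ν ν * no ν / 2 := by
  unfold selfHartree halfFill; ring

/-- **A total-density Hartree level carries the FULL on-site term `U_νν n_ν`** (both halves), so that removing
the self half leaves Misawa–Nakamura–Imada's `μ_ν + U_νν n_ν/2 + Σ_{ν′≠ν} U_νν′ n_ν′` (`dressed_orbital`):
`ksHartreeLevel μ (spinOrbU Uo) (U_νν) (halfFill no) (ν, s) = μ (ν, s) + Uo ν ν * no ν + Σ_{ν′≠ν} Uo ν ν′ * no ν′`.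
[cite: MisawaNakamuraImada2011, p. 2]; [cite: MoreeEtAl2022, App. A Eq. (A15)] -/
theorem ksHartreeLevel_orbital (μ : ι × Bool → ℝ) (Uo : ι → ι → ℝ) (no : ι → ℝ) (ν : ι) (s : Bool) :
    ksHartreeLevel μ (spinOrbU Uo) (fun x : ι × Bool => Uo x.1 x.1) (halfFill no) (ν, s)
      = μ (ν, s) + Uo ν ν * no ν + ∑ ν' ∈ univ.erase ν, Uo ν ν' * no ν' := by
  unfold ksHartreeLevel
  rw [dressed_orbital, selfHartree_orbital]
  ring

end OrbitalSelf

end PictureMap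

end Literature.MathematicalPhysics.QuantumLattice
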